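import Literature.AnabelianGeometry.SemiGraphs.ProSigmaCompletionExtend
import Literature.GroupTheory.CombinatorialGroupTheory.PuncturedSurfaceGroup
import Mathlib.Algebra.BigOperators.Fin
import Mathlib.Topology.Instances.ZMod
import Mathlib.Algebra.Group.TypeTags.Finite
import HarnessLib

/-!
# Inertia of distinct cusps is disjoint up to conjugacy (pro-`Σ`, at least three cusps)

[SemiAnbd] Example 2.10 (p. 31) / [AbsAnab] Lemma 1.3.7: in the pro-`Σ` completion `ι : Γ_{g,r} → P` of a
hyperbolic punctured surface group, the closed procyclic cusp inertia subgroups `I_i = closure ι⟨c_i⟩`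
satisfy `I_i ∩ x I_j x⁻¹ = 1` for `i ≠ j` (and are malnormal) — abc-iut-L3-t11's named fact
`ProSigmaCuspInertiaMalnormal` (`SurfaceTypeEstranged.lean`), input of "totally estranged"
[cite: MochizukiSemiAnbd2006, Ex. 2.10 p.31].  This file PROVES the disjointness clause for DISTINCT
cusps when `r ≥ 3`, by the elementary character argument: with a third cusp `k`, the assignment
`c_i ↦ 1`, `c_k ↦ −1`, every other generator `↦ 0` is a character `Γ_{g,r} → ℤ/n` (the relator has
total cusp weight `1 − 1 = 0`); its continuous extension `χ : P → ℤ/n` kills `x I_j x⁻¹` and is `s` on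
`ι(c_i)^s`, so an element of the intersection lies in `ι(c_i)^{nℤ} · K ⊆ N₀` for every open normal `N₀`.

Not covered here (honest scope): the case `r = 2` (`c₁ ≡ c₂⁻¹` in homology, so no character separates
the two cusps) and malnormality `i = j` — both need non-abelian finite quotients.  Theorems only.
-/

namespace Literature.GroupTheory.CombinatorialGroupTheory.PuncturedSurfaceGroup

open Multiplicative

variable {g r : ℕ}

/-- **Cusp characters of `Γ_{g,r}`**: for weights `w : Fin r → ℤ/n` with `∑ w = 0` there is a
homomorphism `Γ_{g,r} → ℤ/n` (written multiplicatively) with `c_k ↦ w k` and `a_i, b_i ↦ 0` — the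
relator `∏[a_i,b_i]·∏ c_k` maps to `∑ w = 0`. [cite: MochizukiSemiAnbd2006, Ex. 2.10 p.31] -/
theorem exists_cuspCharacter {n : ℕ} (w : Fin r → ZMod n) (hw : ∑ k, w k = 0) :
    ∃ φ : PuncturedSurfaceGroup g r →* Multiplicative (ZMod n), ∀ k, φ (c k) = ofAdd (w k) := by
  classical
  let f : puncturedSurfaceGen g r → Multiplicative (ZMod n) := Sum.elim (fun _ => 1) fun k => ofAdd (w k)
  have hrel : ∀ v ∈ ({relator g r} : Set (FreeGroup (puncturedSurfaceGen g r))),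
      FreeGroup.lift f v = 1 := by
    intro v hv
    rw [Set.mem_singleton_iff] at hv
    subst hv
    simp only [relator, map_mul, map_list_prod, List.map_map, Function.comp_def, map_inv, genA, genB,
      genC, FreeGroup.lift_apply_of]
    have h1 : ((List.finRange g).map fun i =>
        f (Sum.inl (i, false)) * f (Sum.inl (i, true)) * (f (Sum.inl (i, false)))⁻¹ *
          (f (Sum.inl (i, true)))⁻¹).prod = 1 :=
      List.prod_eq_one fun y hy => by
        obtain ⟨i, -, rfl⟩ := List.mem_map.mp hy
        simp [f]
    have h2 : ((List.finRange r).map fun k => f (Sum.inr k)).prod = 1 := by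
      simp only [f, Sum.elim_inr]
      rw [show (fun k => ofAdd (w k)) = ofAdd ∘ w from rfl, ← List.map_map, ← ofAdd_list_prod,
        ← Fin.sum_univ_def, hw, ofAdd_zero]
    rw [h1, h2, one_mul]
  refine ⟨PresentedGroup.toGroup hrel, fun k => ?_⟩
  rw [c, PresentedGroup.toGroup.of]
  rfl

end Literature.GroupTheory.CombinatorialGroupTheory.PuncturedSurfaceGroup

namespace Literature.AnabelianGeometry.SemiGraphs.SemiGraphOfAnabelioids

open Literature.AnabelianGeometry.Anabelioids Literature.GroupTheory.CombinatorialGroupTheory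
open Multiplicative
open scoped Pointwise

universe v

/-- Among three or more cusps there is one different from two given ones.
[cite: MochizukiSemiAnbd2006, Ex. 2.10 p.31] -/
theorem exists_third_cusp {r : ℕ} (h3 : 3 ≤ r) (i j : Fin r) : ∃ k : Fin r, k ≠ i ∧ k ≠ j := by
  by_contra hcon
  push Not at hcon
  have h0 := hcon ⟨0, by omega⟩
  have h1 := hcon ⟨1, by omega⟩
  have h2 := hcon ⟨2, by omega⟩
  -- three distinct elements cannot all lie in `{i, j}`
  rcases em ((⟨0, by omega⟩ : Fin r) = i) with e0 | e0
  · have e1 : (⟨1, by omega⟩ : Fin r) = j := h1 (by rw [← e0]; simp [Fin.ext_iff])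
    have e2i : (⟨2, by omega⟩ : Fin r) ≠ i := by rw [← e0]; simp [Fin.ext_iff]
    have e2j : (⟨2, by omega⟩ : Fin r) ≠ j := by rw [← e1]; simp [Fin.ext_iff]
    exact e2j (h2 e2i)
  · have e0j : (⟨0, by omega⟩ : Fin r) = j := h0 e0
    have e1j : (⟨1, by omega⟩ : Fin r) ≠ j := by rw [← e0j]; simp [Fin.ext_iff]
    have e1i : (⟨1, by omega⟩ : Fin r) = i := by
      by_contra h; exact e1j (h1 h)
    have e2i : (⟨2, by omega⟩ : Fin r) ≠ i := by rw [← e1i]; simp [Fin.ext_iff]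
    have e2j : (⟨2, by omega⟩ : Fin r) ≠ j := by rw [← e0j]; simp [Fin.ext_iff]
    exact e2j (h2 e2i)

/-- The closure of a subgroup `S` lies in `S · K` for every open normal subgroup `K`.
[cite: MochizukiSemiAnbd2006, Ex. 2.10 p.31] -/
theorem topologicalClosure_le_sup_of_isOpen {P : Type v} [Group P] [TopologicalSpace P]
    [IsTopologicalGroup P] (S K : Subgroup P) (hK : IsOpen (K : Set P)) :
    S.topologicalClosure ≤ S ⊔ K :=
  S.topologicalClosure_minimal le_sup_left
    (Subgroup.isClosed_of_isOpen _ (Subgroup.isOpen_mono le_sup_right hK))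

/-- **Distinct cusps have disjoint inertia up to conjugacy (`r ≥ 3`).**  For a pro-`Σ` completion
`ι : Γ_{g,r} → P` (`P` profinite) with `r ≥ 3`, distinct cusps `i ≠ j` and any `x ∈ P`:
`closure ι⟨c_i⟩ ∩ x · closure ι⟨c_j⟩ · x⁻¹ = 1` — the `i ≠ j` clause of
`ProSigmaCuspInertiaMalnormal` in this range. [cite: MochizukiSemiAnbd2006, Ex. 2.10 p.31] -/
theorem cuspInertia_closure_inf_conj_eq_bot_of_ne {Sigma : Set ℕ} {g r : ℕ} (h3 : 3 ≤ r)
    {P : Type v} [Group P] [TopologicalSpace P] [IsTopologicalGroup P] [CompactSpace P]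
    [T2Space P] [TotallyDisconnectedSpace P] (ι : PuncturedSurfaceGroup g r →* P)
    (hι : IsProSigmaCompletion Sigma ι) {i j : Fin r} (hij : i ≠ j) (x : P) :
    ((PuncturedSurfaceGroup.cuspInertia (g := g) i).map ι).topologicalClosure ⊓
        ConjAct.toConjAct x •
          ((PuncturedSurfaceGroup.cuspInertia (g := g) j).map ι).topologicalClosure = ⊥ := by
  classical
  rw [eq_bot_iff]
  rintro y ⟨hyI, hyJ⟩
  rw [Subgroup.mem_bot]
  by_contra hy1
  -- an open normal `N₀` missing `y`, of `Σ`-index `n`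
  obtain ⟨N₀, hN₀⟩ := ProfiniteGrp.exist_openNormalSubgroup_sub_open_nhds_of_one
    (isOpen_compl_singleton (x := y)) (show (1 : P) ∈ ({y}ᶜ : Set P) from fun h => hy1 h.symm)
  have hyN₀ : y ∉ (N₀ : Subgroup P) := fun h => hN₀ h rfl
  haveI : (N₀ : Subgroup P).Normal := N₀.isNormal'
  obtain ⟨n, hndef⟩ : ∃ n, n = (N₀ : Subgroup P).index := ⟨_, rfl⟩
  have hn : IsSigmaInteger Sigma n := hndef ▸ hι.index_open _ N₀.isNormal' N₀.isOpen'
  haveI : NeZero n := ⟨hn.1.ne'⟩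
  have hcard : IsSigmaInteger Sigma (Nat.card (Multiplicative (ZMod n))) := by
    rw [show Nat.card (Multiplicative (ZMod n)) = n from Nat.card_zmod n]; exact hn
  -- the cusp character `c_i ↦ 1`, `c_k ↦ -1` (third cusp `k`), all else `↦ 0`, extended to `P`
  obtain ⟨k, hki, hkj⟩ := exists_third_cusp h3 i j
  let w : Fin r → ZMod n := fun l => (if l = i then 1 else 0) + (if l = k then -1 else 0)
  have hw : ∑ l, w l = 0 := by
    simp only [w, Finset.sum_add_distrib, Finset.sum_ite_eq', Finset.mem_univ, if_true]
    exact add_neg_cancel 1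
  obtain ⟨φ, hφ⟩ := PuncturedSurfaceGroup.exists_cuspCharacter (g := g) w hw
  have hφi : φ (PuncturedSurfaceGroup.c i) = ofAdd 1 := by
    rw [hφ]; simp [w, Ne.symm hki]
  have hφj : φ (PuncturedSurfaceGroup.c j) = 1 := by
    rw [hφ]; simp [w, Ne.symm hij, Ne.symm hkj]
  obtain ⟨χ, hχc, hχ⟩ := hι.exists_continuous_extend_top hcard φ
  -- the level `K = N₀ ∩ Ker χ`
  have hk₁ : IsOpen (χ.ker : Set P) := (isOpen_discrete ({1} : Set _)).preimage hχc
  let Kχ : OpenNormalSubgroup P := { toSubgroup := χ.ker, isOpen' := hk₁ }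
  let K : OpenNormalSubgroup P := N₀ ⊓ Kχ
  have hKle₀ : (K : Subgroup P) ≤ (N₀ : Subgroup P) := fun z hz => hz.1
  have hKleχ : (K : Subgroup P) ≤ χ.ker := fun z hz => hz.2
  haveI : (K : Subgroup P).Normal := K.isNormal'
  -- `y ∈ ι⟨c_i⟩ · K`
  have hyI' := topologicalClosure_le_sup_of_isOpen _ (K : Subgroup P) K.isOpen' hyI
  rw [← SetLike.mem_coe, Subgroup.mul_normal] at hyI'
  obtain ⟨s, hs, k₁, hk₁K, hy⟩ := hyI'
  simp only [PuncturedSurfaceGroup.cuspInertia, MonoidHom.map_zpowers, SetLike.mem_coe] at hs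
  obtain ⟨σ, rfl⟩ := Subgroup.mem_zpowers_iff.mp hs
  -- `y ∈ x · (ι⟨c_j⟩ · K) · x⁻¹`
  obtain ⟨y', hy', hxy⟩ := (Subgroup.mem_smul_pointwise_iff_exists _ _ _).mp hyJ
  have hyJ' := topologicalClosure_le_sup_of_isOpen _ (K : Subgroup P) K.isOpen' hy'
  rw [← SetLike.mem_coe, Subgroup.mul_normal] at hyJ'
  obtain ⟨t, ht, k₂, hk₂K, hy''⟩ := hyJ'
  simp only [PuncturedSurfaceGroup.cuspInertia, MonoidHom.map_zpowers, SetLike.mem_coe] at ht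
  obtain ⟨τ, rfl⟩ := Subgroup.mem_zpowers_iff.mp ht
  -- evaluate `χ` on `y` both ways
  have e1 : χ y = ofAdd ((σ : ℤ) : ZMod n) := by
    rw [← hy, map_mul, (hKleχ hk₁K : χ k₁ = 1), mul_one, map_zpow, hχ, hφi, ← ofAdd_zsmul, zsmul_one]
  have e2 : χ y = 1 := by
    rw [← hxy, ConjAct.toConjAct_smul, map_mul, map_mul, ← hy'', map_mul,
      (hKleχ hk₂K : χ k₂ = 1), mul_one, map_zpow, hχ, hφj, one_zpow, mul_one, map_inv,
      mul_inv_cancel]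
  have hdvd : (n : ℤ) ∣ σ := by
    rw [e2, eq_comm, ofAdd_eq_one, ZMod.intCast_zmod_eq_zero_iff_dvd] at e1
    exact e1
  -- hence `ι(c_i)^σ ∈ N₀` and `y ∈ N₀`
  obtain ⟨d, hd⟩ := hdvd
  have hτn : ι (PuncturedSurfaceGroup.c i) ^ (n : ℤ) ∈ (N₀ : Subgroup P) := by
    rw [zpow_natCast, hndef]
    exact Subgroup.pow_index_mem _ _
  have hτs : ι (PuncturedSurfaceGroup.c i) ^ σ ∈ (N₀ : Subgroup P) := by
    rw [hd, zpow_mul]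
    exact Subgroup.zpow_mem _ hτn d
  exact hyN₀ (hy ▸ (N₀ : Subgroup P).mul_mem hτs (hKle₀ hk₁K))

end Literature.AnabelianGeometry.SemiGraphs.SemiGraphOfAnabelioids
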